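import Mathlib
import Literature.Analysis.Complex.StripResidueFormula
import Literature.Analysis.SpecialFunctions.GammaStirlingOrder
import HarnessLib

/-!
# ζ(5) search — the Mellin–Barnes integral for `(1+w)^{-(m+1)}` (cell `pub-zeta5`, seat ct-1 g11)

HONEST FRAMING: systematic search; no irrationality claim unless kernel-certified. Nothing in this file is an
irrationality result, a worthiness exponent or a denominator statement. It is the analytic input of Brown–Zudilin's
derivation of the Barnes-type double integral (16) from the 12-parameter integral (10) [BrownZudilin2022, Sect. 5]:
"Applying now the Barnes integral representation … where the vertical line `Re s = −c` separates the poles of `Γ(−s)`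
from those of `Γ(αⱼ+s)`", in the special case actually needed there (a `₁F₀`, i.e. a binomial):

* `mellin_barnes` — for real `w > 0`, `m : ℕ` and `0 < σ < m+1`,
  `(1+w)^{-(m+1)} = (1/2π) ∫_ℝ w^{s} Γ(m+1+s) Γ(−s) / m! dy`, `s = −σ + iy`
  (Mathlib's Mellin inversion theorem `mellinInv_mellin_eq` applied to `t ↦ (1+t)^{-(m+1)}`, whose Mellin transform is
  the Beta integral `Γ(s)Γ(m+1−s)/m!`, `mellin_oneAdd_inv_pow`);
* `integrable_Gamma_vertical` / `integrable_Gamma_vertical'` — `y ↦ Γ(σ+iy)Γ(m+1−σ−iy)` is integrable on `ℝ`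
  (reflection formula `Γ(s)Γ(1−s) = π/sin πs`, `|sin(x+iy)| ≥ |sinh y|`, hence exponential decay `e^{-(π-1)|y|}`).
Theorems only (no new definitions).
-/

noncomputable section

namespace Summit.KontsevichZagierPeriods.Zeta5Search.BarnesMellin

open MeasureTheory Set Filter Asymptotics
open scoped Topology Real

/-! ### 1. `Γ(s)Γ(m+1−s)` on a vertical line: product formula, exponential decay, integrability
(the elementary bounds `|sinh (Im z)| ≤ ‖sin z‖` and `e^u/4 ≤ sinh u` are the tree's
`Literature.Analysis.SpecialFunctions.abs_sinh_im_le_norm_sin` and `Literature.Analysis.Complex.exp_div_four_le_sinh`) -/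

/-- Reflection + functional equation: `Γ(s)Γ(m+1−s) = (π / sin πs) ∏_{k<m} (k+1−s)` off the real axis. -/
theorem Gamma_mul_Gamma_nat_add_one_sub {s : ℂ} (hs : s.im ≠ 0) (m : ℕ) :
    Complex.Gamma s * Complex.Gamma ((m : ℂ) + 1 - s) =
      (π : ℂ) / Complex.sin (π * s) * ∏ k ∈ Finset.range m, ((k : ℂ) + 1 - s) := by
  induction m with
  | zero => simp [Complex.Gamma_mul_Gamma_one_sub]
  | succ m ih =>
    have hne : (m : ℂ) + 1 - s ≠ 0 := by
      intro h
      have := congrArg Complex.im h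
      simp at this
      exact hs this
    rw [Finset.prod_range_succ, show ((m + 1 : ℕ) : ℂ) + 1 - s = ((m : ℂ) + 1 - s) + 1 by push_cast; ring,
      Complex.Gamma_add_one _ hne, mul_left_comm, ih]
    ring

/-- Exponential decay on the vertical line `Re s = σ`, `|Im s| ≥ 1`:
`‖Γ(s)Γ(m+1−s)‖ ≤ 4π·m!·e^{m+|σ|}·e^{-(π-1)|y|}`. -/
theorem norm_Gamma_mul_Gamma_le (σ : ℝ) (m : ℕ) {y : ℝ} (hy : 1 ≤ |y|) :
    ‖Complex.Gamma ((σ : ℂ) + (y : ℂ) * Complex.I) * Complex.Gamma ((m : ℂ) + 1 - ((σ : ℂ) + (y : ℂ) * Complex.I))‖ ≤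
      (4 * π * m.factorial * Real.exp (m + |σ|)) * Real.exp (-(π - 1) * |y|) := by
  set s : ℂ := (σ : ℂ) + (y : ℂ) * Complex.I with hs_def
  have him : s.im = y := by simp [hs_def]
  have hs : s.im ≠ 0 := by
    rw [him]; intro h; rw [h, abs_zero] at hy; linarith
  rw [Gamma_mul_Gamma_nat_add_one_sub hs m, norm_mul, norm_div, Complex.norm_real, Real.norm_eq_abs,
    abs_of_pos Real.pi_pos]
  -- the sine
  have hsin : Real.exp (π * |y|) / 4 ≤ ‖Complex.sin (π * s)‖ := by
    have h1 := Literature.Analysis.SpecialFunctions.abs_sinh_im_le_norm_sin (π * s)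
    have him' : ((π : ℂ) * s).im = π * y := by simp [hs_def]
    rw [him'] at h1
    have h2 : 1 ≤ |π * y| := by
      rw [abs_mul, abs_of_pos Real.pi_pos]; nlinarith [Real.pi_gt_three, hy, abs_nonneg y]
    have h3 : Real.exp |π * y| / 4 ≤ |Real.sinh (π * y)| := by rw [Real.abs_sinh]; exact Literature.Analysis.Complex.exp_div_four_le_sinh h2
    rw [abs_mul, abs_of_pos Real.pi_pos] at h3
    exact h3.trans h1
  have hsin_pos : 0 < ‖Complex.sin (π * s)‖ := lt_of_lt_of_le (by positivity) hsin
  -- the polynomial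
  have hnorm_s : ‖s‖ ≤ |σ| + |y| := by
    calc ‖s‖ ≤ ‖(σ : ℂ)‖ + ‖(y : ℂ) * Complex.I‖ := norm_add_le _ _
      _ = |σ| + |y| := by simp
  have hprod : ‖∏ k ∈ Finset.range m, ((k : ℂ) + 1 - s)‖ ≤ m.factorial * Real.exp (m + |σ| + |y|) := by
    rw [norm_prod]
    have hk : ∀ k ∈ Finset.range m, ‖(k : ℂ) + 1 - s‖ ≤ m + |σ| + |y| := by
      intro k hk
      have hk' : (k : ℝ) + 1 ≤ m := by
        have := Finset.mem_range.mp hk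
        exact_mod_cast this
      calc ‖(k : ℂ) + 1 - s‖ ≤ ‖(k : ℂ) + 1‖ + ‖s‖ := norm_sub_le _ _
        _ ≤ (k + 1) + (|σ| + |y|) := by
            gcongr
            rw [show (k : ℂ) + 1 = ((k + 1 : ℕ) : ℂ) by push_cast; ring, Complex.norm_natCast]
            push_cast; exact le_rfl
        _ ≤ m + |σ| + |y| := by linarith
    calc ∏ k ∈ Finset.range m, ‖(k : ℂ) + 1 - s‖ ≤ ∏ _k ∈ Finset.range m, (m + |σ| + |y|) :=
          Finset.prod_le_prod (fun _ _ => norm_nonneg _) hk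
      _ = (m + |σ| + |y|) ^ m := by simp
      _ ≤ m.factorial * Real.exp (m + |σ| + |y|) := by
          have h := Real.pow_div_factorial_le_exp (m + |σ| + |y|) (by positivity) m
          rw [div_le_iff₀ (by positivity)] at h
          linarith [h]
  -- combine
  have hpi : π / ‖Complex.sin (π * s)‖ ≤ π / (Real.exp (π * |y|) / 4) :=
    div_le_div_of_nonneg_left Real.pi_pos.le (by positivity) hsin
  calc π / ‖Complex.sin (↑π * s)‖ * ‖∏ k ∈ Finset.range m, ((k : ℂ) + 1 - s)‖
      ≤ (π / (Real.exp (π * |y|) / 4)) * (m.factorial * Real.exp (m + |σ| + |y|)) :=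
        mul_le_mul hpi hprod (norm_nonneg _) (by positivity)
    _ = (4 * π * m.factorial * Real.exp (m + |σ|)) * Real.exp (-(π - 1) * |y|) := by
        have e1 : Real.exp (m + |σ| + |y|) = Real.exp (m + |σ|) * Real.exp |y| := by rw [← Real.exp_add]
        have e2 : Real.exp (-(π - 1) * |y|) * Real.exp (π * |y|) = Real.exp |y| := by
          rw [← Real.exp_add]; ring_nf
        have e3 : Real.exp (π * |y|) ≠ 0 := (Real.exp_pos _).ne'
        rw [e1, ← e2]; field_simp

/-- No poles on the line: `σ + iy ≠ −n` for `σ > 0`. -/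
theorem ne_neg_nat_of_re_pos {s : ℂ} (hs : 0 < s.re) (n : ℕ) : s ≠ -(n : ℂ) := by
  intro h
  have := congrArg Complex.re h
  simp at this
  linarith [n.cast_nonneg (α := ℝ)]

/-- Continuity of `y ↦ Γ(σ+iy)Γ(m+1−σ−iy)` for `0 < σ < m+1`. -/
theorem continuous_Gamma_vertical {σ : ℝ} (m : ℕ) (hσ : 0 < σ) (hσ' : σ < m + 1) :
    Continuous fun y : ℝ =>
      Complex.Gamma ((σ : ℂ) + (y : ℂ) * Complex.I) * Complex.Gamma ((m : ℂ) + 1 - ((σ : ℂ) + (y : ℂ) * Complex.I)) := by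
  have hc1 : Continuous fun y : ℝ => (σ : ℂ) + (y : ℂ) * Complex.I := by fun_prop
  have hc2 : Continuous fun y : ℝ => (m : ℂ) + 1 - ((σ : ℂ) + (y : ℂ) * Complex.I) := by fun_prop
  refine Continuous.mul ?_ ?_
  · refine continuous_iff_continuousAt.mpr fun y => (Complex.continuousAt_Gamma _ ?_).comp hc1.continuousAt
    exact ne_neg_nat_of_re_pos (by simp [hσ])
  · refine continuous_iff_continuousAt.mpr fun y => (Complex.continuousAt_Gamma _ ?_).comp hc2.continuousAt
    exact ne_neg_nat_of_re_pos (by simp; linarith)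

/-- `y ↦ e^{-b|y|}` is integrable on `ℝ` for `b > 0`. -/
theorem integrable_exp_neg_mul_abs {b : ℝ} (hb : 0 < b) : Integrable fun y : ℝ => Real.exp (-b * |y|) := by
  have h1 : IntegrableOn (fun y : ℝ => Real.exp (-b * |y|)) (Ioi 0) := by
    refine (integrableOn_exp_mul_Ioi (show -b < 0 by linarith) 0).congr_fun (fun y hy => ?_) measurableSet_Ioi
    rw [abs_of_pos (mem_Ioi.mp hy)]
  have h2 : IntegrableOn (fun y : ℝ => Real.exp (-b * |y|)) (Iic 0) := by
    refine (integrableOn_exp_mul_Iic hb 0).congr_fun (fun y hy => ?_) measurableSet_Iic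
    rw [abs_of_nonpos (mem_Iic.mp hy)]; ring_nf
  have := h2.union h1
  rwa [Iic_union_Ioi, integrableOn_univ] at this

/-- A continuous function with an exponential tail bound is integrable on `ℝ`. -/
theorem integrable_of_norm_le_exp {F : ℝ → ℂ} (hF : Continuous F) {C b R : ℝ} (hb : 0 < b)
    (hbound : ∀ y : ℝ, R ≤ |y| → ‖F y‖ ≤ C * Real.exp (-b * |y|)) : Integrable F := by
  obtain ⟨M, hM⟩ := (isCompact_Icc : IsCompact (Icc (-|R|) |R|)).exists_bound_of_continuousOn hF.continuousOn
  set C' : ℝ := max C 0 + max M 0 * Real.exp (b * |R|) with hC'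
  refine Integrable.mono' ((integrable_exp_neg_mul_abs hb).const_mul C') hF.aestronglyMeasurable
    (Eventually.of_forall fun y => ?_)
  have hpos : 0 < Real.exp (-b * |y|) := Real.exp_pos _
  by_cases h : R ≤ |y|
  · calc ‖F y‖ ≤ C * Real.exp (-b * |y|) := hbound y h
      _ ≤ C' * Real.exp (-b * |y|) := by
          gcongr
          have : (0 : ℝ) ≤ max M 0 * Real.exp (b * |R|) := by positivity
          calc C ≤ max C 0 := le_max_left _ _
            _ ≤ C' := by rw [hC']; linarith
  · have h : |y| < R := not_le.mp h
    have hyI : y ∈ Icc (-|R|) |R| := by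
      rw [mem_Icc]; constructor <;> cases abs_lt.mp (h.trans_le (le_abs_self R)) <;> linarith
    have h1 : ‖F y‖ ≤ max M 0 := (hM y hyI).trans (le_max_left _ _)
    have h2 : (1 : ℝ) ≤ Real.exp (b * |R|) * Real.exp (-b * |y|) := by
      rw [← Real.exp_add]
      apply Real.one_le_exp
      have : |y| ≤ |R| := (h.trans_le (le_abs_self R)).le
      nlinarith
    calc ‖F y‖ ≤ max M 0 * (Real.exp (b * |R|) * Real.exp (-b * |y|)) := by
          nlinarith [le_max_right M 0]
      _ ≤ C' * Real.exp (-b * |y|) := by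
          rw [hC']; nlinarith [le_max_right C 0, Real.exp_pos (b * |R|)]

/-- **Vertical integrability** of `y ↦ Γ(σ+iy)Γ(m+1−σ−iy)` for `0 < σ < m+1`. -/
theorem integrable_Gamma_vertical {σ : ℝ} (m : ℕ) (hσ : 0 < σ) (hσ' : σ < m + 1) :
    Integrable fun y : ℝ =>
      Complex.Gamma ((σ : ℂ) + (y : ℂ) * Complex.I) * Complex.Gamma ((m : ℂ) + 1 - ((σ : ℂ) + (y : ℂ) * Complex.I)) := by
  have hb : 0 < π - 1 := by linarith [Real.pi_gt_three]
  exact integrable_of_norm_le_exp (continuous_Gamma_vertical m hσ hσ') hb (R := 1)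
    (fun y hy => norm_Gamma_mul_Gamma_le σ m hy)

/-! ### 2. The Mellin transform of `t ↦ (1+t)^{-(m+1)}` is `Γ(s)Γ(m+1−s)/m!` -/

/-- Complex powers of a quotient of non-negative reals. -/
theorem cpow_ofReal_div {a b : ℝ} (ha : 0 ≤ a) (hb : 0 < b) (z : ℂ) :
    (((a / b : ℝ)) : ℂ) ^ z = (a : ℂ) ^ z * (b : ℂ) ^ (-z) := by
  rw [div_eq_mul_inv, Complex.ofReal_mul, Complex.mul_cpow_ofReal_nonneg ha (inv_nonneg.mpr hb.le),
    Complex.ofReal_inv, Complex.inv_cpow, Complex.cpow_neg]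
  rw [Complex.arg_ofReal_of_nonneg hb.le]
  exact Real.pi_ne_zero.symm

/-- The map `x ↦ x/(1−x)` sends `(0,1)` onto `(0,∞)`. -/
theorem image_div_one_sub : (fun x : ℝ => x / (1 - x)) '' Ioo (0 : ℝ) 1 = Ioi 0 := by
  ext t
  constructor
  · rintro ⟨x, hx, rfl⟩
    exact div_pos hx.1 (by linarith [hx.2])
  · intro ht
    have ht' : (0 : ℝ) < t := ht
    refine ⟨t / (1 + t), ⟨div_pos ht' (by linarith), by rw [div_lt_one (by linarith)]; linarith⟩, ?_⟩
    have h1 : (1 : ℝ) + t ≠ 0 := by linarith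
    field_simp
    ring

/-- `x ↦ x/(1−x)` is injective on `(0,1)`. -/
theorem injOn_div_one_sub : InjOn (fun x : ℝ => x / (1 - x)) (Ioo (0 : ℝ) 1) := by
  intro x hx x' hx' h
  have h1 : (1 : ℝ) - x ≠ 0 := by linarith [hx.2]
  have h2 : (1 : ℝ) - x' ≠ 0 := by linarith [hx'.2]
  simp only at h
  rw [div_eq_div_iff h1 h2] at h
  nlinarith

/-- Derivative of `x ↦ x/(1−x)` inside `(0,1)`. -/
theorem hasDerivWithinAt_div_one_sub {x : ℝ} (hx : x ∈ Ioo (0 : ℝ) 1) :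
    HasDerivWithinAt (fun x : ℝ => x / (1 - x)) (1 / (1 - x) ^ 2) (Ioo (0 : ℝ) 1) x := by
  have h1 : (1 : ℝ) - x ≠ 0 := by linarith [hx.2]
  have h := (hasDerivAt_id x).div ((hasDerivAt_id x).const_sub 1) h1
  refine (h.congr_deriv ?_).hasDerivWithinAt
  simp only [id]
  field_simp
  ring

/-- The substituted Beta integrand: for `x ∈ (0,1)`,
`|1/(1−x)²| · (x/(1−x))^{s−1} · (1 + x/(1−x))^{-(m+1)} = x^{s−1}(1−x)^{(m+1−s)−1}`. -/
theorem subst_integrand {x : ℝ} (hx : x ∈ Ioo (0 : ℝ) 1) (s : ℂ) (m : ℕ) :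
    |1 / (1 - x) ^ 2| • (((x / (1 - x) : ℝ) : ℂ) ^ (s - 1) * ((1 + ((x / (1 - x) : ℝ) : ℂ)) ^ (m + 1))⁻¹) =
      (x : ℂ) ^ (s - 1) * (1 - (x : ℂ)) ^ ((m : ℂ) + 1 - s - 1) := by
  have hx0 : 0 < x := hx.1
  have hx1 : 0 < 1 - x := by linarith [hx.2]
  have hb : ((1 - x : ℝ) : ℂ) ≠ 0 := by exact_mod_cast hx1.ne'
  rw [cpow_ofReal_div hx0.le hx1 (s - 1)]
  have h1 : (1 : ℂ) + ((x / (1 - x) : ℝ) : ℂ) = (((1 - x : ℝ) : ℂ))⁻¹ := by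
    rw [Complex.ofReal_div]
    field_simp
    push_cast; ring
  rw [h1, inv_pow, inv_inv, abs_of_pos (by positivity), Complex.real_smul]
  have e1 : (((1 / (1 - x) ^ 2 : ℝ)) : ℂ) = ((1 - x : ℝ) : ℂ) ^ (-(2 : ℂ)) := by
    rw [Complex.cpow_neg, show (2 : ℂ) = ((2 : ℕ) : ℂ) by norm_num, Complex.cpow_natCast]
    push_cast; ring
  have e2 : (((1 - x : ℝ) : ℂ)) ^ (m + 1) = ((1 - x : ℝ) : ℂ) ^ (((m + 1 : ℕ)) : ℂ) :=
    (Complex.cpow_natCast _ _).symm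
  rw [e1, e2]
  have e3 : ((1 - x : ℝ) : ℂ) ^ (-(2 : ℂ)) * ((x : ℂ) ^ (s - 1) * ((1 - x : ℝ) : ℂ) ^ (-(s - 1)) *
      ((1 - x : ℝ) : ℂ) ^ (((m + 1 : ℕ)) : ℂ)) =
      (x : ℂ) ^ (s - 1) * (((1 - x : ℝ) : ℂ) ^ (-(2 : ℂ)) * ((1 - x : ℝ) : ℂ) ^ (-(s - 1)) *
        ((1 - x : ℝ) : ℂ) ^ (((m + 1 : ℕ)) : ℂ)) := by ring
  rw [e3, ← Complex.cpow_add _ _ hb, ← Complex.cpow_add _ _ hb,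
    show (-(2 : ℂ) + -(s - 1) + ((m + 1 : ℕ) : ℂ)) = (m : ℂ) + 1 - s - 1 by push_cast; ring]
  push_cast
  rfl

/-- Continuity of `t ↦ (1+t)^{-(m+1)}` at every `t > -1`. -/
theorem continuousAt_oneAdd_inv_pow (m : ℕ) {t : ℝ} (ht : -1 < t) :
    ContinuousAt (fun t : ℝ => ((1 + (t : ℂ)) ^ (m + 1))⁻¹) t := by
  have hc : Continuous fun t : ℝ => (1 + (t : ℂ)) ^ (m + 1) := by fun_prop
  refine hc.continuousAt.inv₀ (pow_ne_zero _ ?_)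
  have : (1 : ℂ) + (t : ℂ) = ((1 + t : ℝ) : ℂ) := by push_cast; ring
  rw [this]; exact_mod_cast (show (1 + t : ℝ) ≠ 0 by linarith)

/-- Norm of `(1+t)^{-(m+1)}` for `t > -1`. -/
theorem norm_oneAdd_inv_pow (m : ℕ) {t : ℝ} (ht : -1 < t) :
    ‖((1 + (t : ℂ)) ^ (m + 1))⁻¹‖ = ((1 + t) ^ (m + 1))⁻¹ := by
  rw [norm_inv, norm_pow, show (1 : ℂ) + (t : ℂ) = ((1 + t : ℝ) : ℂ) by push_cast; ring, Complex.norm_real,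
    Real.norm_of_nonneg (by linarith)]

/-- The Mellin transform of `t ↦ (1+t)^{-(m+1)}` converges on `0 < Re s < m+1`. -/
theorem mellinConvergent_oneAdd_inv_pow (m : ℕ) {s : ℂ} (hs : 0 < s.re) (hs' : s.re < m + 1) :
    MellinConvergent (fun t : ℝ => ((1 + (t : ℂ)) ^ (m + 1))⁻¹) s := by
  have hcont : ContinuousOn (fun t : ℝ => ((1 + (t : ℂ)) ^ (m + 1))⁻¹) (Ioi 0) :=
    continuousOn_of_forall_continuousAt fun t ht =>
      continuousAt_oneAdd_inv_pow m (by linarith [mem_Ioi.mp ht])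
  refine mellinConvergent_of_isBigO_rpow (a := (m : ℝ) + 1) (b := 0)
    (hcont.locallyIntegrableOn measurableSet_Ioi) ?_ (by simpa using hs') ?_ (by simpa using hs)
  · refine IsBigO.of_bound 1 ?_
    filter_upwards [eventually_ge_atTop (1 : ℝ)] with x hx
    have hx0 : 0 < x := by linarith
    rw [norm_oneAdd_inv_pow m (by linarith), one_mul, Real.norm_of_nonneg (Real.rpow_nonneg hx0.le _),
      Real.rpow_neg hx0.le, show (m : ℝ) + 1 = ((m + 1 : ℕ) : ℝ) by push_cast; ring, Real.rpow_natCast]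
    exact inv_anti₀ (pow_pos hx0 _) (pow_le_pow_left₀ hx0.le (by linarith) _)
  · refine IsBigO.of_bound 1 ?_
    filter_upwards [self_mem_nhdsWithin] with x hx
    have hx0 : 0 < x := hx
    rw [norm_oneAdd_inv_pow m (by linarith), neg_zero, Real.rpow_zero, norm_one, mul_one]
    exact inv_le_one_of_one_le₀ (one_le_pow₀ (by linarith))

/-- **The Mellin transform of `(1+t)^{-(m+1)}`** is the Beta integral `Γ(s)Γ(m+1−s)/m!` on `0 < Re s < m+1`. -/
theorem mellin_oneAdd_inv_pow (m : ℕ) {s : ℂ} (hs : 0 < s.re) (hs' : s.re < m + 1) :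
    mellin (fun t : ℝ => ((1 + (t : ℂ)) ^ (m + 1))⁻¹) s =
      Complex.Gamma s * Complex.Gamma ((m : ℂ) + 1 - s) / (m.factorial : ℂ) := by
  have hcv := integral_image_eq_integral_abs_deriv_smul measurableSet_Ioo
    (fun x hx => hasDerivWithinAt_div_one_sub hx) injOn_div_one_sub
    (fun t : ℝ => (t : ℂ) ^ (s - 1) • ((1 + (t : ℂ)) ^ (m + 1))⁻¹)
  rw [image_div_one_sub] at hcv
  rw [mellin, hcv]
  have hpt : ∀ x ∈ Ioo (0 : ℝ) 1,
      |1 / (1 - x) ^ 2| • (((x / (1 - x) : ℝ) : ℂ) ^ (s - 1) • ((1 + ((x / (1 - x) : ℝ) : ℂ)) ^ (m + 1))⁻¹) =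
        (x : ℂ) ^ (s - 1) * (1 - (x : ℂ)) ^ ((m : ℂ) + 1 - s - 1) := by
    intro x hx
    rw [smul_eq_mul]
    exact subst_integrand hx s m
  rw [setIntegral_congr_fun measurableSet_Ioo hpt]
  have hB : ∫ x in Ioo (0 : ℝ) 1, (x : ℂ) ^ (s - 1) * (1 - (x : ℂ)) ^ ((m : ℂ) + 1 - s - 1) =
      Complex.betaIntegral s ((m : ℂ) + 1 - s) := by
    rw [Complex.betaIntegral, intervalIntegral.integral_of_le zero_le_one, integral_Ioc_eq_integral_Ioo]
  rw [hB]
  have hre : 0 < ((m : ℂ) + 1 - s).re := by simp; linarith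
  have key := Complex.Gamma_mul_Gamma_eq_betaIntegral hs hre
  rw [show s + ((m : ℂ) + 1 - s) = (m : ℂ) + 1 by ring, Complex.Gamma_nat_eq_factorial] at key
  have hm : (m.factorial : ℂ) ≠ 0 := by exact_mod_cast m.factorial_ne_zero
  rw [eq_div_iff hm, mul_comm, key]

/-! ### 3. The Mellin–Barnes integral -/

/-- Vertical integrability of the Mellin transform of `(1+t)^{-(m+1)}` on `Re s = σ ∈ (0, m+1)`. -/
theorem verticalIntegrable_mellin_oneAdd_inv_pow (m : ℕ) {σ : ℝ} (hσ : 0 < σ) (hσ' : σ < m + 1) :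
    Complex.VerticalIntegrable (mellin fun t : ℝ => ((1 + (t : ℂ)) ^ (m + 1))⁻¹) σ := by
  unfold Complex.VerticalIntegrable
  have heq : (fun y : ℝ => mellin (fun t : ℝ => ((1 + (t : ℂ)) ^ (m + 1))⁻¹) ((σ : ℂ) + (y : ℂ) * Complex.I)) =
      fun y : ℝ => Complex.Gamma ((σ : ℂ) + (y : ℂ) * Complex.I) *
        Complex.Gamma ((m : ℂ) + 1 - ((σ : ℂ) + (y : ℂ) * Complex.I)) / (m.factorial : ℂ) := by
    funext y
    exact mellin_oneAdd_inv_pow m (by simpa using hσ) (by simpa using hσ')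
  rw [heq]
  exact (integrable_Gamma_vertical m hσ hσ').div_const _

/-- **Mellin–Barnes integral for a binomial** [BrownZudilin2022, Sect. 5, "Barnes integral representation", case `₁F₀`]:
for real `w > 0`, `m : ℕ`, `0 < σ < m+1`,
`(1+w)^{-(m+1)} = (1/2π) ∫_ℝ w^{s} Γ(m+1+s)Γ(−s)/m! dy` with `s = −σ+iy` (the line `Re s = −σ` separates the poles of
`Γ(−s)` from those of `Γ(m+1+s)`). -/
theorem mellin_barnes (m : ℕ) {w σ : ℝ} (hw : 0 < w) (hσ : 0 < σ) (hσ' : σ < m + 1) :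
    ((1 + (w : ℂ)) ^ (m + 1))⁻¹ =
      (1 / (2 * π) : ℂ) * ∫ y : ℝ, (w : ℂ) ^ (-(σ : ℂ) + (y : ℂ) * Complex.I) *
        (Complex.Gamma ((m : ℂ) + 1 + (-(σ : ℂ) + (y : ℂ) * Complex.I)) *
          Complex.Gamma (-(-(σ : ℂ) + (y : ℂ) * Complex.I)) / (m.factorial : ℂ)) := by
  set f : ℝ → ℂ := fun t => ((1 + (t : ℂ)) ^ (m + 1))⁻¹ with hf
  have hinv := mellinInv_mellin_eq σ f hw (mellinConvergent_oneAdd_inv_pow m (by simpa using hσ)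
    (by simpa using hσ')) (verticalIntegrable_mellin_oneAdd_inv_pow m hσ hσ') (continuousAt_oneAdd_inv_pow m (by linarith))
  rw [show ((1 + (w : ℂ)) ^ (m + 1))⁻¹ = f w from rfl, ← hinv, mellinInv, Complex.real_smul]
  push_cast
  congr 1
  set B : ℝ → ℂ := fun y => (w : ℂ) ^ (-(σ : ℂ) + (y : ℂ) * Complex.I) *
        (Complex.Gamma ((m : ℂ) + 1 + (-(σ : ℂ) + (y : ℂ) * Complex.I)) *
          Complex.Gamma (-(-(σ : ℂ) + (y : ℂ) * Complex.I)) / (m.factorial : ℂ)) with hB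
  have hA : ∀ y : ℝ, (w : ℂ) ^ (-((σ : ℂ) + (y : ℂ) * Complex.I)) • mellin f ((σ : ℂ) + (y : ℂ) * Complex.I) = B (-y) := by
    intro y
    rw [mellin_oneAdd_inv_pow m (by simpa using hσ) (by simpa using hσ'), smul_eq_mul, hB]
    simp only [Complex.ofReal_neg]
    rw [show -(σ : ℂ) + -(y : ℂ) * Complex.I = -((σ : ℂ) + (y : ℂ) * Complex.I) by ring,
      show (m : ℂ) + 1 + -((σ : ℂ) + (y : ℂ) * Complex.I) = (m : ℂ) + 1 - ((σ : ℂ) + (y : ℂ) * Complex.I) by ring,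
      neg_neg]
    ring
  calc ∫ y : ℝ, (w : ℂ) ^ (-((σ : ℂ) + (y : ℂ) * Complex.I)) • mellin f ((σ : ℂ) + (y : ℂ) * Complex.I)
      = ∫ y : ℝ, B (-y) := by congr 1; funext y; exact hA y
    _ = ∫ y : ℝ, B y := integral_neg_eq_self B volume

/-- The weight `Γ(m+1+s)Γ(−s)`, `s = −σ+iy`, is integrable in `y` … -/
theorem integrable_Gamma_vertical' (m : ℕ) {σ : ℝ} (hσ : 0 < σ) (hσ' : σ < m + 1) :
    Integrable fun y : ℝ => Complex.Gamma ((m : ℂ) + 1 + (-(σ : ℂ) + (y : ℂ) * Complex.I)) *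
      Complex.Gamma (-(-(σ : ℂ) + (y : ℂ) * Complex.I)) := by
  have h := (integrable_Gamma_vertical m hσ hσ').comp_neg
  refine h.congr (Eventually.of_forall fun y => ?_)
  simp only [Complex.ofReal_neg]
  rw [show (m : ℂ) + 1 + (-(σ : ℂ) + (y : ℂ) * Complex.I) = (m : ℂ) + 1 - ((σ : ℂ) + -(y : ℂ) * Complex.I) by ring,
    show -(-(σ : ℂ) + (y : ℂ) * Complex.I) = (σ : ℂ) + -(y : ℂ) * Complex.I by ring, mul_comm]

/-- … and continuous in `y`. -/
theorem continuous_Gamma_vertical' (m : ℕ) {σ : ℝ} (hσ : 0 < σ) (hσ' : σ < m + 1) :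
    Continuous fun y : ℝ => Complex.Gamma ((m : ℂ) + 1 + (-(σ : ℂ) + (y : ℂ) * Complex.I)) *
      Complex.Gamma (-(-(σ : ℂ) + (y : ℂ) * Complex.I)) := by
  have h := (continuous_Gamma_vertical m hσ hσ').comp continuous_neg
  refine h.congr fun y => ?_
  simp only [Function.comp, Complex.ofReal_neg]
  rw [show (m : ℂ) + 1 + (-(σ : ℂ) + (y : ℂ) * Complex.I) = (m : ℂ) + 1 - ((σ : ℂ) + -(y : ℂ) * Complex.I) by ring,
    show -(-(σ : ℂ) + (y : ℂ) * Complex.I) = (σ : ℂ) + -(y : ℂ) * Complex.I by ring, mul_comm]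

end Summit.KontsevichZagierPeriods.Zeta5Search.BarnesMellin

end
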